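import Summits.ValiantsHypothesis.ValiantsHypothesis.Theorems.FreeSubtorusOrbitDimensionBoundStubStableReductionAtomBlock
import Summits.ValiantsHypothesis.ValiantsHypothesis.Theorems.FreeSubtorusOrbitDimensionBoundStubStableReductionSplit

/-!
# `OrbitDimensionBound` (stmt-ValiantsHypothesis-16133), rung line `square_covering` — stub `stub_stableReduction`,
# part C₃: twisted Schur lemma and the permutation of block types — every stable block is equivariant

Helper file for stub 1 `stub_stableReduction` of `Cruxes/OrbitDimensionBound/Lines/square_covering.lean` (route
`FreeSubtorus`).  Input (from part C₂, `exists_blockDiagonal_form`): a finite family of STABLE square polynomial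
matrices `blk i` (`det ≠ 0`, not block-decomposable) and, for every `γ` in a group `D` of diagonal substitutions,
constant matrices `X_{ij}, Y_{ij}` with the twisted intertwining relations `Y_{ij} (blk j)_e = γ^e (blk i)_e X_{ij}` and,
for each `j`, some `X_{ij} ≠ 0`.

* `twisted_schur` — a twisted morphism between stable pencils is zero or an isomorphism (kernel and image pairs are
  balanced sub-pencils; King: `θ`-stable objects are simple);
* **`blocks_equivariant`** — if moreover `D` is `M`-divisible with `(#ι)! ∣ M`, then EVERY block is `D`-equivariant:
  "`blk i` is `γ`-twisted-isomorphic to `blk j`" is functional up to honest isomorphism, so each `δ ∈ D` induces a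
  permutation `π_δ` of the finite set of isomorphism types, `π_δ^{M} = 1`, and `γ = δ^M` fixes every type, i.e.
  `blk i (γ·x) = g · blk i · h⁻¹`.

Helper mode (`--supports stmt-ValiantsHypothesis-16133 --as helper`).  Honest framing: [folklore] linear algebra and
finite combinatorics toward ONE registered stub (`stub_stableReduction`, M) of a dormant rung line whose load-bearing stub
`stub_gradedPowerCount` is OPEN; the crux `OrbitDimensionBound`, the route `FreeSubtorus` and VP ≠ VNP are OPEN and are
not moved by this file.

## References (orientation only)
* A. D. King, Quart. J. Math. 45 (1994), §3 (Schur's lemma for `θ`-stable representations).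
-/

set_option linter.dupNamespace false

namespace Summit.ValiantsHypothesis.ValiantsHypothesis.Theorems.FreeSubtorusOrbitDimensionBound.SquareCovering.StableReduction

open Matrix MvPolynomial Module
open Literature.Computability.AlgebraicComplexity
open Summit.ValiantsHypothesis.ValiantsHypothesis.Theorems.FreeSubtorusOrbitDimensionBound.SignCovering.PerSummand

variable {σ : Type*} [Fintype σ] [DecidableEq σ]

/-! ### §1 The scalar `γ^e` of a diagonal substitution -/

section Scalar

/-- `1^e = 1`. [folklore] -/
theorem prod_diag_pow_one (e : σ →₀ ℕ) : (∏ p ∈ e.support, ((1 : GL σ ℂ) : Matrix σ σ ℂ) p p ^ e p) = 1 :=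
  Finset.prod_eq_one fun p _ => by rw [Units.val_one, Matrix.one_apply_eq, one_pow]

/-- `(γδ)^e = γ^e δ^e` for diagonal `γ, δ`. [folklore] -/
theorem prod_diag_pow_mul (γ δ : GL σ ℂ) (t t' : σ → ℂ) (hγ : (γ : Matrix σ σ ℂ) = Matrix.diagonal t)
    (hδ : (δ : Matrix σ σ ℂ) = Matrix.diagonal t') (e : σ →₀ ℕ) :
    (∏ p ∈ e.support, ((γ * δ : GL σ ℂ) : Matrix σ σ ℂ) p p ^ e p) =
      (∏ p ∈ e.support, (γ : Matrix σ σ ℂ) p p ^ e p) * ∏ p ∈ e.support, (δ : Matrix σ σ ℂ) p p ^ e p := by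
  rw [← Finset.prod_mul_distrib]
  refine Finset.prod_congr rfl fun p _ => ?_
  rw [Units.val_mul, hγ, hδ, Matrix.diagonal_mul_diagonal, Matrix.diagonal_apply_eq, Matrix.diagonal_apply_eq,
    Matrix.diagonal_apply_eq, mul_pow]

/-- `γ^e ≠ 0`. [folklore] -/
theorem prod_diag_pow_ne_zero (γ : GL σ ℂ) (t : σ → ℂ) (hγ : (γ : Matrix σ σ ℂ) = Matrix.diagonal t) (e : σ →₀ ℕ) :
    (∏ p ∈ e.support, (γ : Matrix σ σ ℂ) p p ^ e p) ≠ 0 := by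
  have h := prod_pow_ne_zero_of_diagonal γ t hγ e
  rwa [show (∏ p ∈ e.support, t p ^ e p) = ∏ p ∈ e.support, (γ : Matrix σ σ ℂ) p p ^ e p from
    Finset.prod_congr rfl fun p _ => by rw [hγ, Matrix.diagonal_apply_eq]] at h

end Scalar

/-! ### §2 Twisted Schur lemma -/

section Schur

omit [Fintype σ] [DecidableEq σ] in
/-- **Twisted Schur lemma.**  Let `M` (`d × d`) and `M'` (`d' × d'`) be STABLE polynomial matrices (`det ≠ 0`, not
block-decomposable) and `X, Y` constant `d × d'` matrices with `Y · M'_e = c_e · M_e · X` for all monomials `e`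
(`c_e ≠ 0`).  Then either `X = 0 = Y`, or `X` and `Y` are invertible (the kernel pair is a balanced sub-pencil of `M'`,
the image pair a balanced sub-pencil of `M`). [folklore] -/
theorem twisted_schur {d d' : ℕ} (M : Matrix (Fin d) (Fin d) (MvPolynomial σ ℂ))
    (M' : Matrix (Fin d') (Fin d') (MvPolynomial σ ℂ)) (hM : M.det ≠ 0) (hMs : ¬ IsBlockDecomposable M)
    (hM' : M'.det ≠ 0) (hM's : ¬ IsBlockDecomposable M') (c : (σ →₀ ℕ) → ℂ) (hc : ∀ e, c e ≠ 0)
    (X Y : Matrix (Fin d) (Fin d') ℂ) (hrel : ∀ e, Y * M'.map (coeff e) = c e • (M.map (coeff e) * X)) :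
    (X = 0 ∧ Y = 0) ∨
      ∃ X' Y' : Matrix (Fin d') (Fin d) ℂ, X' * X = 1 ∧ X * X' = 1 ∧ Y' * Y = 1 ∧ Y * Y' = 1 := by
  classical
  -- kernel pair: a sub-pencil of `M'`
  have hker : ∀ (e : σ →₀ ℕ) (v : Fin d' → ℂ), v ∈ LinearMap.ker (Matrix.toLin' X) →
      Matrix.toLin' (M'.map (coeff e)) v ∈ LinearMap.ker (Matrix.toLin' Y) := by
    intro e v hv
    simp only [LinearMap.mem_ker, Matrix.toLin'_apply] at hv ⊢
    rw [Matrix.mulVec_mulVec, hrel e, Matrix.smul_mulVec, ← Matrix.mulVec_mulVec, hv, Matrix.mulVec_zero,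
      smul_zero]
  -- image pair: a sub-pencil of `M`
  have him : ∀ (e : σ →₀ ℕ) (w : Fin d → ℂ), w ∈ LinearMap.range (Matrix.toLin' X) →
      Matrix.toLin' (M.map (coeff e)) w ∈ LinearMap.range (Matrix.toLin' Y) := by
    rintro e w ⟨v, rfl⟩
    refine ⟨(c e)⁻¹ • M'.map (coeff e) *ᵥ v, ?_⟩
    rw [Matrix.toLin'_apply, Matrix.toLin'_apply, Matrix.toLin'_apply, Matrix.mulVec_smul, Matrix.mulVec_mulVec, hrel e,
      Matrix.smul_mulVec, smul_smul, inv_mul_cancel₀ (hc e), one_smul, Matrix.mulVec_mulVec]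
  have hrnX := LinearMap.finrank_range_add_finrank_ker (Matrix.toLin' X)
  have hrnY := LinearMap.finrank_range_add_finrank_ker (Matrix.toLin' Y)
  rw [Module.finrank_fin_fun] at hrnX hrnY
  -- semistability inequalities
  have h1 : finrank ℂ (LinearMap.ker (Matrix.toLin' X)) ≤ finrank ℂ (LinearMap.ker (Matrix.toLin' Y)) := by
    by_contra hlt
    exact hM' (det_eq_zero_of_subpencil M' _ _ hker (not_le.1 hlt))
  have h2 : finrank ℂ (LinearMap.range (Matrix.toLin' X)) ≤ finrank ℂ (LinearMap.range (Matrix.toLin' Y)) := by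
    by_contra hlt
    exact hM (det_eq_zero_of_subpencil M _ _ him (not_le.1 hlt))
  have hkeq : finrank ℂ (LinearMap.ker (Matrix.toLin' X)) = finrank ℂ (LinearMap.ker (Matrix.toLin' Y)) := by omega
  have hieq : finrank ℂ (LinearMap.range (Matrix.toLin' X)) = finrank ℂ (LinearMap.range (Matrix.toLin' Y)) := by
    omega
  have hkle : finrank ℂ (LinearMap.ker (Matrix.toLin' X)) ≤ d' := by
    simpa [Module.finrank_fin_fun] using Submodule.finrank_le (LinearMap.ker (Matrix.toLin' X))
  have hile : finrank ℂ (LinearMap.range (Matrix.toLin' X)) ≤ d := by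
    simpa [Module.finrank_fin_fun] using Submodule.finrank_le (LinearMap.range (Matrix.toLin' X))
  by_cases hk : finrank ℂ (LinearMap.ker (Matrix.toLin' X)) = d'
  · -- `X = 0`, hence `Y = 0`
    left
    have hkX : LinearMap.ker (Matrix.toLin' X) = ⊤ :=
      Submodule.eq_top_of_finrank_eq (by rw [hk, Module.finrank_fin_fun])
    have hkY : LinearMap.ker (Matrix.toLin' Y) = ⊤ :=
      Submodule.eq_top_of_finrank_eq (by rw [← hkeq, hk, Module.finrank_fin_fun])
    rw [LinearMap.ker_eq_top] at hkX hkY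
    exact ⟨(Matrix.toLin'.map_eq_zero_iff).1 hkX, (Matrix.toLin'.map_eq_zero_iff).1 hkY⟩
  by_cases hk0 : finrank ℂ (LinearMap.ker (Matrix.toLin' X)) = 0
  · -- `X, Y` injective; then the image pair is all of `ℂ^d`
    right
    by_cases hd' : d' = 0
    · subst hd'
      exact absurd hk0 hk
    have hile' : ¬ finrank ℂ (LinearMap.range (Matrix.toLin' X)) < d := by
      intro hlt
      exact hMs (isBlockDecomposable_of_subpencil M _ _ him hieq (by omega) hlt)
    have hid : finrank ℂ (LinearMap.range (Matrix.toLin' X)) = d := le_antisymm hile (not_lt.1 hile')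
    obtain rfl : d' = d := by omega
    have hXu : IsUnit X := by
      rw [← Matrix.mulVec_injective_iff_isUnit]
      have : LinearMap.ker (Matrix.toLin' X) = ⊥ := Submodule.finrank_eq_zero.1 hk0
      rw [LinearMap.ker_eq_bot] at this
      exact this
    have hYu : IsUnit Y := by
      rw [← Matrix.mulVec_injective_iff_isUnit]
      have : LinearMap.ker (Matrix.toLin' Y) = ⊥ := Submodule.finrank_eq_zero.1 (hkeq ▸ hk0)
      rw [LinearMap.ker_eq_bot] at this
      exact this
    exact ⟨X⁻¹, Y⁻¹, Matrix.nonsing_inv_mul X ((Matrix.isUnit_iff_isUnit_det X).1 hXu),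
      Matrix.mul_nonsing_inv X ((Matrix.isUnit_iff_isUnit_det X).1 hXu),
      Matrix.nonsing_inv_mul Y ((Matrix.isUnit_iff_isUnit_det Y).1 hYu),
      Matrix.mul_nonsing_inv Y ((Matrix.isUnit_iff_isUnit_det Y).1 hYu)⟩
  · -- a proper balanced kernel pair decomposes `M'`
    exfalso
    exact hM's (isBlockDecomposable_of_subpencil M' _ _ hker hkeq (Nat.pos_of_ne_zero hk0)
      (lt_of_le_of_ne hkle hk))

end Schur

/-! ### §3 The permutation of block types; every stable block is equivariant -/

section Types

variable {ι : Type*} [Fintype ι]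

/-- **Every stable block is equivariant** (see the module docstring): the relation "`blk i` is `γ`-twisted isomorphic
to `blk j`" is reflexive at `γ = 1`, composable, invertible and everywhere defined (twisted Schur + a non-zero block in
every column of an invertible matrix), hence functional on isomorphism types; a `δ ∈ D` induces a permutation of the
finitely many types, of order dividing `(#ι)!`, so `γ = δ^M` fixes every type. [folklore] -/
theorem blocks_equivariant (d : ι → ℕ) (blk : (i : ι) → Matrix (Fin (d i)) (Fin (d i)) (MvPolynomial σ ℂ))
    (hdet : ∀ i, (blk i).det ≠ 0) (hstab : ∀ i, ¬ IsBlockDecomposable (blk i))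
    (D : Subgroup (GL σ ℂ)) (hD : ∀ γ ∈ D, ∃ t : σ → ℂ, (γ : Matrix σ σ ℂ) = Matrix.diagonal t)
    (N : ℕ) (hN : (Fintype.card ι).factorial ∣ N) (hdiv : ∀ γ ∈ D, ∃ δ ∈ D, δ ^ N = γ)
    (hrel : ∀ γ ∈ D, ∃ X Y : (i j : ι) → Matrix (Fin (d i)) (Fin (d j)) ℂ,
      (∀ i j (e : σ →₀ ℕ), Y i j * (blk j).map (coeff e) =
        (∏ p ∈ e.support, (γ : Matrix σ σ ℂ) p p ^ e p) • ((blk i).map (coeff e) * X i j)) ∧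
      (∀ j, ∃ i, X i j ≠ 0)) :
    ∀ γ ∈ D, ∀ i, ∃ g h : GL (Fin (d i)) ℂ, Matrix.linSubstEntries γ (blk i) =
      (g : Matrix (Fin (d i)) (Fin (d i)) ℂ).map C * blk i *
        ((h⁻¹ : GL (Fin (d i)) ℂ) : Matrix (Fin (d i)) (Fin (d i)) ℂ).map C := by
  classical
  -- `R γ i j`: `blk i` (source) is `γ`-twisted isomorphic to `blk j` (target)
  let R : GL σ ℂ → ι → ι → Prop := fun γ i j =>
    ∃ (X Y : Matrix (Fin (d j)) (Fin (d i)) ℂ) (X' Y' : Matrix (Fin (d i)) (Fin (d j)) ℂ),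
      X' * X = 1 ∧ X * X' = 1 ∧ Y' * Y = 1 ∧ Y * Y' = 1 ∧
      ∀ e : σ →₀ ℕ, Y * (blk i).map (coeff e) =
        (∏ p ∈ e.support, (γ : Matrix σ σ ℂ) p p ^ e p) • ((blk j).map (coeff e) * X)
  have hR1 : ∀ i, R 1 i i := fun i =>
    ⟨1, 1, 1, 1, Matrix.mul_one _, Matrix.mul_one _, Matrix.mul_one _, Matrix.mul_one _, fun e => by
      rw [prod_diag_pow_one, one_smul, Matrix.one_mul, Matrix.mul_one]⟩
  have hR2 : ∀ γ δ : GL σ ℂ, γ ∈ D → δ ∈ D → ∀ i j k, R γ i j → R δ j k → R (δ * γ) i k := by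
    rintro γ δ hγ hδ i j k ⟨X₁, Y₁, X₁', Y₁', hX₁, hX₁', hY₁, hY₁', h₁⟩ ⟨X₂, Y₂, X₂', Y₂', hX₂, hX₂', hY₂, hY₂', h₂⟩
    obtain ⟨t, ht⟩ := hD γ hγ
    obtain ⟨t', ht'⟩ := hD δ hδ
    refine ⟨X₂ * X₁, Y₂ * Y₁, X₁' * X₂', Y₁' * Y₂', ?_, ?_, ?_, ?_, fun e => ?_⟩
    · rw [Matrix.mul_assoc, ← Matrix.mul_assoc X₂', hX₂, Matrix.one_mul, hX₁]
    · rw [Matrix.mul_assoc, ← Matrix.mul_assoc X₁, hX₁', Matrix.one_mul, hX₂']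
    · rw [Matrix.mul_assoc, ← Matrix.mul_assoc Y₂', hY₂, Matrix.one_mul, hY₁]
    · rw [Matrix.mul_assoc, ← Matrix.mul_assoc Y₁, hY₁', Matrix.one_mul, hY₂']
    · rw [Matrix.mul_assoc, h₁ e, Matrix.mul_smul, ← Matrix.mul_assoc, h₂ e, Matrix.smul_mul, smul_smul,
        Matrix.mul_assoc, prod_diag_pow_mul δ γ t' t ht' ht e,
        mul_comm (∏ p ∈ e.support, (γ : Matrix σ σ ℂ) p p ^ e p)]
  have hR3 : ∀ γ : GL σ ℂ, γ ∈ D → ∀ i j, R γ i j → R γ⁻¹ j i := by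
    rintro γ hγ i j ⟨X, Y, X', Y', hX, hX', hY, hY', h⟩
    obtain ⟨t, ht⟩ := hD γ hγ
    obtain ⟨t', ht'⟩ := hD γ⁻¹ (D.inv_mem hγ)
    refine ⟨X', Y', X, Y, hX', hX, hY', hY, fun e => ?_⟩
    have h2 : (blk i).map (coeff e) * X' = (∏ p ∈ e.support, (γ : Matrix σ σ ℂ) p p ^ e p) • (Y' * (blk j).map (coeff e)) := by
      have h3 := congrArg (fun Z => Y' * Z * X') (h e)
      simp only [← Matrix.mul_assoc, hY, Matrix.one_mul, Matrix.mul_smul, Matrix.smul_mul] at h3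
      rw [h3, Matrix.mul_assoc, hX', Matrix.mul_one]
    rw [h2, smul_smul, ← prod_diag_pow_mul γ⁻¹ γ t' t ht' ht e, inv_mul_cancel, prod_diag_pow_one, one_smul]
  have hR4 : ∀ γ : GL σ ℂ, γ ∈ D → ∀ j, ∃ i, R γ j i := by
    intro γ hγ j
    obtain ⟨t, ht⟩ := hD γ hγ
    obtain ⟨X, Y, hXY, hcol⟩ := hrel γ hγ
    obtain ⟨i, hi⟩ := hcol j
    rcases twisted_schur (blk i) (blk j) (hdet i) (hstab i) (hdet j) (hstab j) _ (prod_diag_pow_ne_zero γ t ht)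
      (X i j) (Y i j) (fun e => hXY i j e) with ⟨hX0, -⟩ | ⟨X', Y', hX', hX, hY', hY⟩
    · exact absurd hX0 hi
    · exact ⟨i, X i j, Y i j, X', Y', hX', hX, hY', hY, fun e => hXY i j e⟩
  -- the setoid of honest isomorphism and the permutation induced by `δ`
  intro γ hγ
  obtain ⟨δ, hδ, rfl⟩ := hdiv γ hγ
  let S : Setoid ι := ⟨fun i j => R 1 i j, ⟨hR1, fun {i j} h => by
    have h' := hR3 1 D.one_mem i j h; rwa [inv_one] at h', fun {i j k} h h' => by
    have h'' := hR2 1 1 D.one_mem D.one_mem i j k h h'; rwa [mul_one] at h''⟩⟩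
  letI : Setoid ι := S
  choose f hf using hR4 δ hδ
  have hcompat : ∀ i j : ι, i ≈ j → f i ≈ f j := by
    intro i j hij
    have h1 := hR3 δ hδ i (f i) (hf i)
    have h2 := hR2 δ⁻¹ 1 (D.inv_mem hδ) D.one_mem (f i) i j h1 hij
    have h3 := hR2 (1 * δ⁻¹) δ (D.mul_mem D.one_mem (D.inv_mem hδ)) hδ (f i) j (f j) h2 (hf j)
    rwa [one_mul, mul_inv_cancel] at h3
  let π : Quotient S → Quotient S := Quotient.map f hcompat
  have hπmk : ∀ i, π ⟦i⟧ = ⟦f i⟧ := fun i => Quotient.map_mk f hcompat i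
  have hπinj : Function.Injective π := by
    intro x y hxy
    induction x using Quotient.inductionOn with | h a => ?_
    induction y using Quotient.inductionOn with | h b => ?_
    rw [hπmk, hπmk] at hxy
    have h1 : R 1 (f a) (f b) := Quotient.exact hxy
    have h2 := hR2 δ 1 hδ D.one_mem a (f a) (f b) (hf a) h1
    have h3 := hR2 (1 * δ) δ⁻¹ (D.mul_mem D.one_mem hδ) (D.inv_mem hδ) a (f b) b h2 (hR3 δ hδ b (f b) (hf b))
    rw [one_mul, inv_mul_cancel] at h3
    exact Quotient.sound h3
  let πe : Equiv.Perm (Quotient S) := Equiv.ofBijective π ⟨hπinj, Finite.surjective_of_injective hπinj⟩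
  have hpow : ∀ (k : ℕ) (a : ι), (πe ^ k) ⟦a⟧ = ⟦f^[k] a⟧ := by
    intro k
    induction k with
    | zero => intro a; rw [pow_zero, Equiv.Perm.one_apply, Function.iterate_zero_apply]
    | succ k ih => intro a; rw [pow_succ', Equiv.Perm.mul_apply, ih, Function.iterate_succ_apply']; exact hπmk _
  have hcard : πe ^ N = 1 := by
    have h1 : Fintype.card (Equiv.Perm (Quotient S)) ∣ N := by
      rw [Fintype.card_perm]
      exact (Nat.factorial_dvd_factorial (Fintype.card_quotient_le S)).trans hN
    obtain ⟨q, hq⟩ := h1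
    rw [hq, pow_mul, pow_card_eq_one, one_pow]
  have hRpow : ∀ (k : ℕ) (a : ι), R (δ ^ k) a (f^[k] a) := by
    intro k
    induction k with
    | zero => intro a; rw [pow_zero, Function.iterate_zero_apply]; exact hR1 a
    | succ k ih =>
      intro a
      have h1 := hR2 (δ ^ k) δ (D.pow_mem hδ k) hδ a _ _ (ih a) (hf _)
      rwa [← pow_succ', ← Function.iterate_succ_apply' f k a] at h1
  -- `γ = δ^N` fixes the type of every block
  intro a
  have hfix : R 1 (f^[N] a) a := by
    have h1 := hpow N a
    rw [hcard, Equiv.Perm.one_apply] at h1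
    exact Quotient.exact h1.symm
  have hRγ : R (δ ^ N) a a := by
    have h1 := hR2 (δ ^ N) 1 (D.pow_mem hδ N) D.one_mem a _ a (hRpow N a) hfix
    rwa [one_mul] at h1
  obtain ⟨X, Y, X', Y', hX, hX', hY, hY', h⟩ := hRγ
  obtain ⟨t, ht⟩ := hD (δ ^ N) (D.pow_mem hδ N)
  refine ⟨⟨Y, Y', hY', hY⟩, ⟨X, X', hX', hX⟩, eq_of_forall_map_coeff _ _ fun e => ?_⟩
  rw [map_coeff_linSubstEntries_diagonal (δ ^ N) t ht, map_coeff_mul_map_C, map_coeff_map_C_mul]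
  change (∏ p ∈ e.support, t p ^ e p) • (blk a).map (coeff e) = Y * (blk a).map (coeff e) * X'
  rw [h e, Matrix.smul_mul, Matrix.mul_assoc, hX', Matrix.mul_one]
  exact congrArg (· • _) (Finset.prod_congr rfl fun p _ => by rw [ht, Matrix.diagonal_apply_eq])

end Types

end Summit.ValiantsHypothesis.ValiantsHypothesis.Theorems.FreeSubtorusOrbitDimensionBound.SquareCovering.StableReduction
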